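import Summits.CriticalPhenomena.PercolationContinuityZ3.Theorems.PercNearOneGluingNoHeavyLowerTailKnQuestion8PocketOddsStep
import HarnessLib

/-!
# KN Question 8 / MC-D at three relays — SUPERADDITIVITY OF THE POCKET ODDS `r_xy ≥ r_x + r_y` (III: assembly)

Support file (`--supports stmt-CriticalPhenomena-4575`, closed), prover `prim-lf-2` (gen 19).  No definitions, no named facts, no sorries;
standard axioms.  Memo `prim-lf-2/PXI-gen19.md` §0(2), §3.  Part III of three (I: `…PocketOddsExchange.lean`, II: `…PocketOddsStep.lean`).

Setting (memos POCKET-CERT-gen16 §1, PXI-gen19 §0): one finite weighted graph, observer `o`, relays `x, y` and the designated relay `z`,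
a down-closed pocket family `𝒟` of vertex sets (none containing the relays, as needed), pocket event `P = {C_o ∈ 𝒟}`.  With
`E1 = {x↮y} ∩ {x↮z}`, `E2 = {y↮x} ∩ {y↮z}`, `F = {x↔y} ∩ {x↮z}` and the O:P likelihood ratios
`r_x = μ({x↔o} ∩ E1)/μ(P ∩ E1)`, `r_y = μ({y↔o} ∩ E2)/μ(P ∩ E2)`, `r_xy = μ({x↔o} ∩ F)/μ(P ∩ F)`, the inequality
  **(club)  `r_xy ≥ r_x + r_y`**   ("superadditivity of the pocket odds")
is the instance `U = {y ∈ C_x}` of the pair-functional pocket covariance comparison PCOV^ξ (memo PXI-gen19 §0(1)); equivalently the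
instance `G = 1{y ∈ ·}` of PCOV (prim-lf-2 gen 16/17; tree `PocketCert.block41_three_of_pcovZ`).  prim-lf-2 gen 19 census: 1 174/1 174,
sharp (ratio up to 0.9993).  Its proof has three steps, all positive association of a SET cluster (vdBHK Thm 2.1) in exchange form:
EXCH-X (`S = {x,y,o}`, `T = {z}`), Step 1 for `(x,y)` and for `(y,x)` (`S = {y,z}`, `T = {x,o}` after exploring `C_S`, vdBHK Lemma 2.4 =
tree `PocketCert.tower_setCl`), and the mediant inequality.
THIS FILE:
* `PocketCert.pocket_odds_superadditive_mul` — (club) in product form `(a·m_F·c₂ + b·m_E1·m_F)·μ(P∩X) ≤ d·m_E1·c₂·μ(P∩X)` (no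
  non-degeneracy hypothesis), from `pocket_exchX`, `pocket_step1` for `(x,y)` and `(y,x)`, and the mediant inequality;
* `PocketCert.pocket_odds_superadditive` — (club): `a·m_F·c₂ + b·m_E1·m_F ≤ d·m_E1·c₂` when `μ(P ∩ X) > 0`.
z-free this is Harris' inequality for `1{o ↔ {x,y}}` and `1{x↔y}`; it is to the pocket covariance comparison PCOV what the indicator case of
the conditioned covariance transfer COV(τ) is to COV(τ) (memo §2).
[cite: VandenbergHaggstromKahn2005, Thm. 2.1 (p. 9), §2.1 Lemma 2.4 (p. 10)] [cite: KozmaNitzan2024, Questions 8–9 (§5.5 p. 36)]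
-/

namespace Summit.CriticalPhenomena.PercolationContinuityZ3.Theorems

open MeasureTheory Set Literature.Probability.LatticeModels Literature.Probability.Percolation
open scoped Classical
open KNPreFKG BHK2006

noncomputable section

namespace PocketCert

variable {V : Type*} [Fintype V]

/-- **(club) — superadditivity of the pocket odds, product form.**  `𝒟` down-closed, no member containing `x`, `y` or `z`,
`P = {C_o ∈ 𝒟}`, `E1 = {x↮y} ∩ {x↮z}`, `E2 = {y↮x} ∩ {y↮z}`, `X = {x↮y} ∩ {x↮z} ∩ {y↮z}`; with
`a = μ({x↔o} ∩ E1)`, `m_E1 = μ(P ∩ E1)`, `b = μ({y↔o} ∩ E2)`, `c₂ = μ(P ∩ E2)`, `d = μ({x↔o} ∩ {x↔y} ∩ {x↮z})`, `m_F = μ(P ∩ {x↔y} ∩ {x↮z})`: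
`(a·m_F·c₂ + b·m_E1·m_F) · μ(P ∩ X) ≤ d·m_E1·c₂ · μ(P ∩ X)`.
Proof: `pocket_exchX` and `pocket_step1` for `(x,y)` and `(y,x)`, then the mediant inequality.
[cite: VandenbergHaggstromKahn2005, Thm. 2.1 (p. 9), §2.1 Lemma 2.4 (p. 10)] [cite: KozmaNitzan2024, Questions 8–9 (§5.5 p. 36)] -/
theorem pocket_odds_superadditive_mul (w : Sym2 V → unitInterval) (o x y z : V) (𝒟 : Set (Set V)) (h𝒟 : IsLowerSet 𝒟)
    (hx : ∀ W ∈ 𝒟, x ∉ W) (hy : ∀ W ∈ 𝒟, y ∉ W) (hz : ∀ W ∈ 𝒟, z ∉ W) :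
    ((prodBernoulli w).real (openConn x o ∩ ({ω | ¬ (openGraph ω).Reachable x y} ∩ {ω | ¬ (openGraph ω).Reachable x z})) *
          (prodBernoulli w).real ({ω : BondConfig V | openCluster ω o ∈ 𝒟} ∩ (openConn x y ∩ {ω | ¬ (openGraph ω).Reachable x z})) *
          (prodBernoulli w).real ({ω : BondConfig V | openCluster ω o ∈ 𝒟} ∩
            ({ω | ¬ (openGraph ω).Reachable y x} ∩ {ω | ¬ (openGraph ω).Reachable y z})) +
        (prodBernoulli w).real (openConn y o ∩ ({ω | ¬ (openGraph ω).Reachable y x} ∩ {ω | ¬ (openGraph ω).Reachable y z})) *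
          (prodBernoulli w).real ({ω : BondConfig V | openCluster ω o ∈ 𝒟} ∩
            ({ω | ¬ (openGraph ω).Reachable x y} ∩ {ω | ¬ (openGraph ω).Reachable x z})) *
          (prodBernoulli w).real ({ω : BondConfig V | openCluster ω o ∈ 𝒟} ∩ (openConn x y ∩ {ω | ¬ (openGraph ω).Reachable x z}))) *
      (prodBernoulli w).real ({ω : BondConfig V | openCluster ω o ∈ 𝒟} ∩ ({ω | ¬ (openGraph ω).Reachable x y} ∩
          {ω | ¬ (openGraph ω).Reachable x z} ∩ {ω | ¬ (openGraph ω).Reachable y z})) ≤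
    (prodBernoulli w).real (openConn x o ∩ openConn x y ∩ {ω | ¬ (openGraph ω).Reachable x z}) *
        (prodBernoulli w).real ({ω : BondConfig V | openCluster ω o ∈ 𝒟} ∩
          ({ω | ¬ (openGraph ω).Reachable x y} ∩ {ω | ¬ (openGraph ω).Reachable x z})) *
        (prodBernoulli w).real ({ω : BondConfig V | openCluster ω o ∈ 𝒟} ∩
          ({ω | ¬ (openGraph ω).Reachable y x} ∩ {ω | ¬ (openGraph ω).Reachable y z})) *
      (prodBernoulli w).real ({ω : BondConfig V | openCluster ω o ∈ 𝒟} ∩ ({ω | ¬ (openGraph ω).Reachable x y} ∩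
          {ω | ¬ (openGraph ω).Reachable x z} ∩ {ω | ¬ (openGraph ω).Reachable y z})) := by
  classical
  set μ := prodBernoulli w with hμ
  have hmeas : ∀ S' : Set (BondConfig V), MeasurableSet S' := fun _ => MeasurableSet.of_discrete
  have hn := fun (S' : Set (BondConfig V)) => (measureReal_nonneg : 0 ≤ μ.real S')
  set P : Set (BondConfig V) := {ω : BondConfig V | openCluster ω o ∈ 𝒟} with hP
  set E1 : Set (BondConfig V) := {ω | ¬ (openGraph ω).Reachable x y} ∩ {ω | ¬ (openGraph ω).Reachable x z} with hE1
  set E2 : Set (BondConfig V) := {ω | ¬ (openGraph ω).Reachable y x} ∩ {ω | ¬ (openGraph ω).Reachable y z} with hE2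
  set X : Set (BondConfig V) := {ω | ¬ (openGraph ω).Reachable x y} ∩ {ω | ¬ (openGraph ω).Reachable x z} ∩
      {ω | ¬ (openGraph ω).Reachable y z} with hX
  set X1 : Set (BondConfig V) := {ω | ¬ (openGraph ω).Reachable x y} ∩ {ω | ¬ (openGraph ω).Reachable x z} ∩
      openConn y z with hX1
  set X' : Set (BondConfig V) := {ω | ¬ (openGraph ω).Reachable y x} ∩ {ω | ¬ (openGraph ω).Reachable y z} ∩
      {ω | ¬ (openGraph ω).Reachable x z} with hX'
  set X2 : Set (BondConfig V) := {ω | ¬ (openGraph ω).Reachable y x} ∩ {ω | ¬ (openGraph ω).Reachable y z} ∩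
      openConn x z with hX2
  set Fv : Set (BondConfig V) := openConn x y ∩ {ω | ¬ (openGraph ω).Reachable x z} with hFv
  -- the three exchange inequalities
  have hexch := pocket_exchX w o x y z 𝒟 h𝒟 hz
  have hs1 := pocket_step1 w o x y z 𝒟 h𝒟 hy hz
  have hs2 := pocket_step1 w o y x z 𝒟 h𝒟 hx hz
  have hXX : X' = X := by
    ext ω
    simp only [hX, hX', mem_inter_iff, mem_setOf_eq]
    constructor
    · rintro ⟨⟨hyx, hyz⟩, hxz⟩; exact ⟨⟨fun h => hyx h.symm, hxz⟩, hyz⟩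
    · rintro ⟨⟨hxy, hxz⟩, hyz⟩; exact ⟨⟨fun h => hxy h.symm, hyz⟩, hxz⟩
  change (μ.real (openConn x o ∩ X) + μ.real (openConn y o ∩ X)) * μ.real (P ∩ Fv) ≤
    μ.real (openConn x o ∩ openConn x y ∩ {ω | ¬ (openGraph ω).Reachable x z}) * μ.real (P ∩ X) at hexch
  change μ.real (openConn x o ∩ X1) * μ.real (P ∩ X) ≤ μ.real (P ∩ X1) * μ.real (openConn x o ∩ X) at hs1
  change μ.real (openConn y o ∩ X2) * μ.real (P ∩ X') ≤ μ.real (P ∩ X2) * μ.real (openConn y o ∩ X') at hs2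
  rw [hXX] at hs2
  -- splitting E1 = X ⊔ X1 and E2 = X ⊔ X2
  have split1 : ∀ B : Set (BondConfig V), μ.real (B ∩ E1) = μ.real (B ∩ X) + μ.real (B ∩ X1) := by
    intro B
    have h := measureReal_inter_add_sdiff₀ (μ := μ) (s := B ∩ E1) (t := openConn y z) (hmeas _).nullMeasurableSet
    have e1 : B ∩ E1 ∩ openConn y z = B ∩ X1 := by
      ext ω; simp only [hE1, hX1, mem_inter_iff]; tauto
    have e2 : (B ∩ E1) \ openConn y z = B ∩ X := by
      ext ω; simp only [hE1, hX, mem_inter_iff, mem_sdiff, openConn, mem_setOf_eq]; tauto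
    rw [e1, e2] at h; linarith
  have split2 : ∀ B : Set (BondConfig V), μ.real (B ∩ E2) = μ.real (B ∩ X) + μ.real (B ∩ X2) := by
    intro B
    have h := measureReal_inter_add_sdiff₀ (μ := μ) (s := B ∩ E2) (t := openConn x z) (hmeas _).nullMeasurableSet
    have e1 : B ∩ E2 ∩ openConn x z = B ∩ X2 := by
      ext ω; simp only [hE2, hX2, mem_inter_iff]; tauto
    have e2 : (B ∩ E2) \ openConn x z = B ∩ X := by
      rw [← hXX]; ext ω; simp only [hE2, hX', mem_inter_iff, mem_sdiff, openConn, mem_setOf_eq]; tauto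
    rw [e1, e2] at h; linarith
  change (μ.real (openConn x o ∩ E1) * μ.real (P ∩ Fv) * μ.real (P ∩ E2) +
      μ.real (openConn y o ∩ E2) * μ.real (P ∩ E1) * μ.real (P ∩ Fv)) * μ.real (P ∩ X) ≤
    μ.real (openConn x o ∩ openConn x y ∩ {ω | ¬ (openGraph ω).Reachable x z}) * μ.real (P ∩ E1) * μ.real (P ∩ E2) *
      μ.real (P ∩ X)
  rw [split1 (openConn x o), split1 P, split2 (openConn y o), split2 P]
  -- the mediant algebra
  set oX := μ.real (openConn x o ∩ X)
  set oX1 := μ.real (openConn x o ∩ X1)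
  set oyX := μ.real (openConn y o ∩ X)
  set oyX2 := μ.real (openConn y o ∩ X2)
  set pX := μ.real (P ∩ X)
  set pX1 := μ.real (P ∩ X1)
  set pX2 := μ.real (P ∩ X2)
  set pF := μ.real (P ∩ Fv)
  set d := μ.real (openConn x o ∩ openConn x y ∩ {ω | ¬ (openGraph ω).Reachable x z})
  have i1 : (oX + oX1) * pX ≤ oX * (pX + pX1) := by nlinarith [hs1, hn (openConn x o ∩ X), hn (P ∩ X)]
  have i2 : (oyX + oyX2) * pX ≤ oyX * (pX + pX2) := by nlinarith [hs2, hn (openConn y o ∩ X), hn (P ∩ X)]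
  have j1 : (oX + oX1) * pX * (pF * (pX + pX2)) ≤ oX * (pX + pX1) * (pF * (pX + pX2)) :=
    mul_le_mul_of_nonneg_right i1 (mul_nonneg (hn _) (add_nonneg (hn _) (hn _)))
  have j2 : (oyX + oyX2) * pX * (pF * (pX + pX1)) ≤ oyX * (pX + pX2) * (pF * (pX + pX1)) :=
    mul_le_mul_of_nonneg_right i2 (mul_nonneg (hn _) (add_nonneg (hn _) (hn _)))
  have j3 : (oX + oyX) * pF * ((pX + pX1) * (pX + pX2)) ≤ d * pX * ((pX + pX1) * (pX + pX2)) :=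
    mul_le_mul_of_nonneg_right hexch (mul_nonneg (add_nonneg (hn _) (hn _)) (add_nonneg (hn _) (hn _)))
  nlinarith [j1, j2, j3]

/-- **(club) — superadditivity of the pocket odds: `r_xy ≥ r_x + r_y`.**  Under `μ(P ∩ X) > 0` (non-degeneracy), with the
masses of `pocket_odds_superadditive_mul`: `a·m_F·c₂ + b·m_E1·m_F ≤ d·m_E1·c₂`, i.e.
`μ({x↔o}∩E1)/μ(P∩E1) + μ({y↔o}∩E2)/μ(P∩E2) ≤ μ({x↔o}∩{x↔y}∩{x↮z})/μ(P∩{x↔y}∩{x↮z})` whenever the denominators are positive —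
the instance `G = 1{y ∈ ·}` of the pocket covariance comparison PCOV (tree `PocketCert.block41_three_of_pcovZ`).
[cite: VandenbergHaggstromKahn2005, Thm. 2.1 (p. 9), §2.1 Lemma 2.4 (p. 10)] [cite: KozmaNitzan2024, Questions 8–9 (§5.5 p. 36)] -/
theorem pocket_odds_superadditive (w : Sym2 V → unitInterval) (o x y z : V) (𝒟 : Set (Set V)) (h𝒟 : IsLowerSet 𝒟)
    (hx : ∀ W ∈ 𝒟, x ∉ W) (hy : ∀ W ∈ 𝒟, y ∉ W) (hz : ∀ W ∈ 𝒟, z ∉ W)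
    (hX : 0 < (prodBernoulli w).real ({ω : BondConfig V | openCluster ω o ∈ 𝒟} ∩ ({ω | ¬ (openGraph ω).Reachable x y} ∩
          {ω | ¬ (openGraph ω).Reachable x z} ∩ {ω | ¬ (openGraph ω).Reachable y z}))) :
    (prodBernoulli w).real (openConn x o ∩ ({ω | ¬ (openGraph ω).Reachable x y} ∩ {ω | ¬ (openGraph ω).Reachable x z})) *
          (prodBernoulli w).real ({ω : BondConfig V | openCluster ω o ∈ 𝒟} ∩ (openConn x y ∩ {ω | ¬ (openGraph ω).Reachable x z})) *
          (prodBernoulli w).real ({ω : BondConfig V | openCluster ω o ∈ 𝒟} ∩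
            ({ω | ¬ (openGraph ω).Reachable y x} ∩ {ω | ¬ (openGraph ω).Reachable y z})) +
        (prodBernoulli w).real (openConn y o ∩ ({ω | ¬ (openGraph ω).Reachable y x} ∩ {ω | ¬ (openGraph ω).Reachable y z})) *
          (prodBernoulli w).real ({ω : BondConfig V | openCluster ω o ∈ 𝒟} ∩
            ({ω | ¬ (openGraph ω).Reachable x y} ∩ {ω | ¬ (openGraph ω).Reachable x z})) *
          (prodBernoulli w).real ({ω : BondConfig V | openCluster ω o ∈ 𝒟} ∩ (openConn x y ∩ {ω | ¬ (openGraph ω).Reachable x z})) ≤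
      (prodBernoulli w).real (openConn x o ∩ openConn x y ∩ {ω | ¬ (openGraph ω).Reachable x z}) *
        (prodBernoulli w).real ({ω : BondConfig V | openCluster ω o ∈ 𝒟} ∩
          ({ω | ¬ (openGraph ω).Reachable x y} ∩ {ω | ¬ (openGraph ω).Reachable x z})) *
        (prodBernoulli w).real ({ω : BondConfig V | openCluster ω o ∈ 𝒟} ∩
          ({ω | ¬ (openGraph ω).Reachable y x} ∩ {ω | ¬ (openGraph ω).Reachable y z})) := by
  have h := pocket_odds_superadditive_mul w o x y z 𝒟 h𝒟 hx hy hz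
  exact le_of_mul_le_mul_right h hX

end PocketCert

end

end Summit.CriticalPhenomena.PercolationContinuityZ3.Theorems
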